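import Summits.Parity.GeneralizedHardyLittlewood.Theses.ChenParityOracleBLAP
import Summits.Parity.GeneralizedHardyLittlewood.Theorems.ChenParityOracleBLAPHostParityFromBrickSwitchedFinal
import HarnessLib

/-!
# Route `ChenParityOracleBLAP` — crux S1 = `HostParityFromBrick` (stmt-Parity-20045): the switched half `K1 → K2 → HP2`

The SWITCHED half of S1, closed: from the brick — K1 = `BilinearLiouvilleMean` and
K2 = `BilinearLiouvilleAP` (both OPEN; Type-II information for `λ(mn ± 2)` on the window
`x^{1/3−δ₁} ≤ M ≤ x^{1/2}`, `x^{1−δ₁} ≤ MN ≤ x`, coefficients 1-bounded and supported on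
`w₀`-rough integers) — the host-parity level statement HP2 for Chen's switched host
`B(x) = {p₁p₂p₃ − 2}`: for every `ε, η > 0`,
`∑_{d ≤ x^{1/2−ε}} |∑_{e ∈ B(x), d ∣ e} λ(e)| ≤ η x/(log x)²` for all large `x`
(`hostParity_switched`).  Proof: `e + 2 = p₂ · (p₁p₃)` is a Type-II product with `m = p₂` in the
window; the sorted triples are cut into `(1 + (log x)^{-9})`-adic classes, the good classes are
literal K-boxes (files `…SwitchedBoxes`, `…SwitchedClass`), the small and boundary classes are
counted (`…SwitchedCount`, `…SwitchedBad`), and the limit is `…SwitchedFinal.switched_eventually`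
with `A = 40` and the common `δ = min δ₁ δ₂` (`window_mono`).  Honesty: this is the bookkeeping half
of a CONDITIONAL reduction; K1, K2 remain open.

References: Chen Jing-run, Sci. Sinica 16 (1973) [ChenSciSinica1973]; G. Harman, *Prime-Detecting
Sieves* (2007), Ch. 3 [Harman2007]; M. B. Nathanson, *Additive Number Theory: The Classical Bases*
(1996), §10.2 [Nathanson1996].
-/

namespace Summit.Parity.GeneralizedHardyLittlewood.Theorems

open Finset Real
open Summit.Parity.GeneralizedHardyLittlewood.Theses.ChenParityOracleBLAP

/-- **The switched half of S1: `K1 → K2 → HP2`.**  From `BilinearLiouvilleMean` and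
`BilinearLiouvilleAP`: for every `ε > 0`, `η > 0` there is `x₀` with
`∑_{d ≤ x^{1/2−ε}} |∑_{e ∈ chenSetB x, d ∣ e} λ(e)| ≤ η x/(log x)²` for all `x ≥ x₀` — verbatim the
second hypothesis of `ParityOracleChen` / the second conjunct of the conclusion of
`HostParityFromBrick`. -/
theorem hostParity_switched (k₁ : BilinearLiouvilleMean) (k₂ : BilinearLiouvilleAP) :
    ∀ ε : ℝ, 0 < ε → ∀ η : ℝ, 0 < η → ∃ x₀ : ℕ, ∀ x : ℕ, x₀ ≤ x →
      (∑ d ∈ Finset.Icc 1 ⌊(x : ℝ) ^ (1 / 2 - ε)⌋₊,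
        |∑ e ∈ (Literature.NumberTheory.Sieve.Chen.chenSetB x).filter (fun e => d ∣ e),
          (ArithmeticFunction.liouville e : ℝ)|) ≤ η * (x : ℝ) / Real.log x ^ 2 := by
  intro ε hε η hη
  obtain ⟨δ₁, hδ₁0, hδ₁1, h1⟩ := k₁
  obtain ⟨δ₂, hδ₂0, hδ₂1, h2⟩ := k₂
  obtain ⟨x₁, hx₁⟩ := h1 40 (by norm_num)
  obtain ⟨x₂, hx₂⟩ := h2 ε hε 40 (by norm_num)
  have hδ0 : 0 < min δ₁ δ₂ := lt_min hδ₁0 hδ₂0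
  have hδ1 : min δ₁ δ₂ ≤ 1 / 3 := (min_le_left _ _).trans (by linarith)
  refine switched_eventually hδ0 hδ1 hε.le (x₁ := max 1 x₁) (x₂ := max 1 x₂) ?_ ?_ hη
  · intro x hx
    have hx1 : 1 ≤ x := le_trans (le_max_left _ _) hx
    exact window_mono hx1 (min_le_left δ₁ δ₂) _ (hx₁ x (le_trans (le_max_right _ _) hx))
  · intro x hx
    have hx1 : 1 ≤ x := le_trans (le_max_left _ _) hx
    exact window_mono hx1 (min_le_right δ₁ δ₂) _ (hx₂ x (le_trans (le_max_right _ _) hx))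

end Summit.Parity.GeneralizedHardyLittlewood.Theorems
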